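import Summits.AtomisticToContinuum.HydrodynamicLimit.Theorems.InformationPercolationEngineChaosClosesEulerReductionSmooth
import Summits.AtomisticToContinuum.HydrodynamicLimit.Theorems.InformationPercolationEngineChaosClosesEulerReductionEuler
import Summits.AtomisticToContinuum.HydrodynamicLimit.Theorems.InformationPercolationEngineChaosClosesEulerReductionFields
import Summits.AtomisticToContinuum.HydrodynamicLimit.Theorems.InformationPercolationEngineChaosClosesEulerWeakEquation
import Summits.AtomisticToContinuum.HydrodynamicLimit.Theorems.JParityClosureLocalSecondLawLedgerJumpB
import HarnessLib

/-!
# Kinetic reduction (crux `ChaosClosesEuler`, stmt-AtomisticToContinuum-15141, line `Sketch`,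
# stub `stub_kineticReduction`) — helper: the exact momentum identity along one orbit

WHAT. Bogolyubov's exact weak equation for the cone-mollified `vₖ`-moments of ONE good orbit (the landed
`ChaosClosesEulerWeakEquation.stub_weakEquation`, tests smooth on all of `ℝ × 𝕋³`), applied with the three components
of the TIME-SHIFTED classical velocity `ũ(s + e, x)` cut off by a smooth plateau (smooth on all of space–time by the
helper `ReductionSmooth`), and summed over `k`: for every `τ` of the window `[0, b]` (`b + e < T`),

`∫⟪ũ(τ+e), m_r(τ)⟫ − ∫⟪ũ(e), m_r(0)⟫ = ∫_{[0,τ]}∫ (⟪∂ₜũ(s+e), m_r(s)⟫ + ∑ᵢⱼ ∂ⱼũᵢ(s+e) Mᵢⱼ(s)) + (N+1)⁻¹ 𝒞(τ)`,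

`M` the cone second moment (`LocalSecondLawLedger.L.Mmom`) and `𝒞(τ)` the ordered-contact-pair collision sum over
`(0, τ]` of `∑ₖ (∫ ũₖ(s+e) b_r(xᵢ(s), ·)) (vᵢₖ − vᵢₖ⁻)` (`momentum_identity_shifted`). Ingredients: the moments of the
weak equation are `m_r` and `M` (finite sums), the plateau is `1` near `[0, b]` so the test, its time derivative and
its space derivatives are those of the shifted field there, and the three `k`-identities are summed inside the
integrals (every integrand is bounded and measurable along the orbit).

REFERENCES. N. N. Bogolyubov, Theor. Math. Phys. 24 (1975) 804; M. Pulvirenti, S. Simonella, arXiv:1504.03215 §1.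
No named fact is invoked.
-/

noncomputable section

namespace Summit.AtomisticToContinuum.HydrodynamicLimit.Theorems.ChaosClosesEulerReduction

open scoped BigOperators Topology Classical MeasureTheory ENNReal InnerProductSpace ContDiff
open Filter Set MeasureTheory Function
open Literature.MathematicalPhysics.KineticTheory
open Literature.Analysis.FluidPDE
open Literature.Analysis.FunctionSpaces
open Summit.AtomisticToContinuum.HydrodynamicLimit.Theorems.LocalSecondLawNegative
open Summit.AtomisticToContinuum.HydrodynamicLimit.Theorems.LocalSecondLawLedger
open Summit.AtomisticToContinuum.HydrodynamicLimit.Theorems.LocalSecondLawLedger.L (Mmom momC_apply_eq_sum Mmom_symm)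

variable {N : ℕ}

/-! ## §1 Vector-valued slices: components of derivatives -/

/-- The derivative of a component of a differentiable curve in `ℝ³` is the component of the derivative. [folklore] -/
theorem deriv_apply_of_differentiableAt {f : ℝ → V3} {s : ℝ} (hf : DifferentiableAt ℝ f s) (k : Fin 3) :
    deriv (fun s' => f s' k) s = (deriv f s) k := by
  have h := ((EuclideanSpace.proj k : V3 →L[ℝ] ℝ).hasFDerivAt).comp_hasDerivAt s hf.hasDerivAt
  have h' : HasDerivAt (fun s' => f s' k) ((deriv f s) k) s := h
  exact h'.deriv

/-- A component of a field smooth on a time set is smooth on that time set. [folklore] -/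
theorem isSmoothSpaceTimeOn_apply {S : Set ℝ} {w : ℝ → T3 → V3} (hw : Torus.IsSmoothSpaceTimeOn S w) (k : Fin 3) :
    Torus.IsSmoothSpaceTimeOn S fun s x => w s x k := by
  have h := hw.continuousLinearMap_comp (EuclideanSpace.proj k : V3 →L[ℝ] ℝ)
  have heq : (⇑(EuclideanSpace.proj k : V3 →L[ℝ] ℝ) ∘ Torus.stLift w) = Torus.stLift fun s x => w s x k := by
    funext p; simp [EuclideanSpace.proj, Torus.stLift]
  unfold Torus.IsSmoothSpaceTimeOn
  rwa [heq] at h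

/-- **The time derivative of a component of the shifted velocity** in the interior: for `s + e ∈ (0, T)`,
`d/ds ũₖ(s + e, x) = (∂ₜũ(s + e, x))ₖ`. [folklore] -/
theorem deriv_shift_apply {T : ℝ} {u : ℝ → T3 → V3} (hu : Torus.IsSmoothSpaceTimeOn (Ico 0 T) u) (e : ℝ) {s : ℝ}
    (hs : s + e ∈ Ioo 0 T) (x : T3) (k : Fin 3) :
    deriv (fun s' => u (s' + e) x k) s = (Torus.timeDerivWithin (Ico 0 T) u (s + e) x) k := by
  have hsI : s + e ∈ Ico 0 T := ⟨hs.1.le, hs.2⟩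
  have hd : HasDerivWithinAt (fun τ => u τ x) (Torus.timeDerivWithin (Ico 0 T) u (s + e) x) (Ico 0 T) (s + e) :=
    hu.hasDerivWithinAt_slice hsI x
  have hd' : HasDerivAt (fun τ => u τ x) (Torus.timeDerivWithin (Ico 0 T) u (s + e) x) (s + e) :=
    hd.hasDerivAt (mem_of_superset (Ioo_mem_nhds hs.1 hs.2) Ioo_subset_Ico_self)
  have hcomp : HasDerivAt (fun s' => u (s' + e) x) (Torus.timeDerivWithin (Ico 0 T) u (s + e) x) s :=
    hd'.comp_add_const s e
  rw [deriv_apply_of_differentiableAt hcomp.differentiableAt k, hcomp.deriv]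

/-! ## §2 The moments of the weak equation are the cone fields -/

/-- The `vₖ`-moment of the weak equation is the `k`-th component of the mollified momentum. [folklore] -/
theorem integral_cone_mul_apply (r : ℝ) (w : Phase N) (x : T3) (k : Fin 3) :
    ∫ q, cone r q.1 x * q.2 k ∂(empiricalMeasure w) = momC r w x k := by
  rw [integral_empiricalMeasure, momC_apply_eq_sum]

/-- The `vₖ`-current of the weak equation is the cone second moment. [folklore] -/
theorem integral_cone_mul_mul_apply (r : ℝ) (w : Phase N) (x : T3) (j k : Fin 3) :
    ∫ q, cone r q.1 x * (q.2 j * q.2 k) ∂(empiricalMeasure w) = Mmom r w x j k := by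
  rw [integral_empiricalMeasure]; rfl

/-! ## §3 The cut-off shifted test of one component -/

section Test

variable {T : ℝ} {u : ℝ → T3 → V3} {e b : ℝ}

/-- **The cut-off shifted component is smooth on all of `ℝ × 𝕋³`.** With `m = T − e − b > 0` and the plateau
`ζ = 1` on `[−e/4, b + m/4]`, `0` off `(−e/2, b + m/2)`, the test `ζ(s) ũₖ(s + e, x)`. [folklore] -/
theorem isSmoothSpaceTimeOn_cutShift (hu : Torus.IsSmoothSpaceTimeOn (Ico 0 T) u) (he : 0 < e) (hbe : b + e < T)
    (k : Fin 3) :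
    Torus.IsSmoothSpaceTimeOn Set.univ fun s x =>
      Real.smoothTransition ((s - (-(e / 2))) / (-(e / 4) - (-(e / 2)))) *
        Real.smoothTransition (((b + (T - e - b) / 2) - s) / ((b + (T - e - b) / 2) - (b + (T - e - b) / 4))) *
      u (s + e) x k := by
  have hw := isSmoothSpaceTimeOn_apply (isSmoothSpaceTimeOn_shift hu e) k
  have hm : 0 < T - e - b := by linarith
  exact isSmoothSpaceTimeOn_univ_mul hw (contDiff_plateau _ _ _ _) (a := -(e / 2)) (d := b + (T - e - b) / 2)
    (by linarith) (by linarith)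
    (fun s hs => plateau_eq_zero_of_le (by linarith) hs)
    (fun s hs => plateau_eq_zero_of_ge (by linarith) hs)

/-- On `[0, b]` (indeed on `[−e/4, b + m/4]`) the plateau is `1`. [folklore] -/
theorem plateau_cutShift_eq_one (he : 0 < e) (hbe : b + e < T) {s : ℝ} (hs : s ∈ Icc (-(e / 4)) (b + (T - e - b) / 4)) :
    Real.smoothTransition ((s - (-(e / 2))) / (-(e / 4) - (-(e / 2)))) *
      Real.smoothTransition (((b + (T - e - b) / 2) - s) / ((b + (T - e - b) / 2) - (b + (T - e - b) / 4))) = 1 :=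
  plateau_eq_one (by linarith) (by linarith) hs

/-- Near every `s ∈ [0, b]` the plateau is `1`. [folklore] -/
theorem eventually_plateau_cutShift_eq_one (he : 0 < e) (hbe : b + e < T) {s : ℝ} (hs : s ∈ Icc 0 b) :
    ∀ᶠ s' in 𝓝 s, Real.smoothTransition ((s' - (-(e / 2))) / (-(e / 4) - (-(e / 2)))) *
      Real.smoothTransition (((b + (T - e - b) / 2) - s') / ((b + (T - e - b) / 2) - (b + (T - e - b) / 4))) = 1 :=
  eventually_plateau_eq_one (by linarith) (by linarith) ⟨by linarith [hs.1], by linarith [hs.2]⟩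

/-- **The time derivative of the cut-off shifted component on `[0, b]`** is the component of the shifted one-sided
time derivative of the classical field. [folklore] -/
theorem deriv_cutShift (hu : Torus.IsSmoothSpaceTimeOn (Ico 0 T) u) (he : 0 < e) (hbe : b + e < T) {s : ℝ}
    (hs : s ∈ Icc 0 b) (x : T3) (k : Fin 3) :
    deriv (fun s' => Real.smoothTransition ((s' - (-(e / 2))) / (-(e / 4) - (-(e / 2)))) *
        Real.smoothTransition (((b + (T - e - b) / 2) - s') / ((b + (T - e - b) / 2) - (b + (T - e - b) / 4))) *
      u (s' + e) x k) s = (Torus.timeDerivWithin (Ico 0 T) u (s + e) x) k := by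
  have hev := eventually_plateau_cutShift_eq_one he hbe hs
  have h1 : deriv (fun s' => Real.smoothTransition ((s' - (-(e / 2))) / (-(e / 4) - (-(e / 2)))) *
        Real.smoothTransition (((b + (T - e - b) / 2) - s') / ((b + (T - e - b) / 2) - (b + (T - e - b) / 4))) *
      u (s' + e) x k) s = deriv (fun s' => u (s' + e) x k) s := by
    refine Filter.EventuallyEq.deriv_eq ?_
    filter_upwards [hev] with s' hs'
    rw [hs', one_mul]
  rw [h1]
  exact deriv_shift_apply hu e ⟨by linarith [hs.1], by linarith [hs.2]⟩ x k

end Test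

/-! ## §4 The exact momentum identity with the shifted classical velocity -/

set_option maxHeartbeats 800000 in
/-- **The exact momentum identity along one good orbit, tested with the shifted classical velocity.** For
`0 < e`, `0 ≤ b`, `b + e < T` and every `τ ∈ [0, b]`:
`∫⟪ũ(τ+e), m_r(τ)⟫ − ∫⟪ũ(e), m_r(0)⟫ = ∫_{[0,τ]}∫ (⟪∂ₜũ(s+e), m_r(s)⟫ + ∑ᵢⱼ ∂ⱼũᵢ(s+e) Mᵢⱼ(s))
  + (N+1)⁻¹ · (ordered-contact-pair collision sum over (0, τ] of ∑ₖ (∫ ũₖ(s+e) b_r(xᵢ(s),·)) (vᵢₖ − vᵢₖ⁻))`.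
[folklore] -/
theorem momentum_identity_shifted {σ : ℝ} (hσ : 0 < σ) (hσ2 : σ < 2⁻¹)
    (Φ : HardSphereFlow (Torus.geometry (Fin 3)) (hsDiameter σ N) (N + 1)) {z : Phase N} (hz : z ∈ Φ.good)
    {r : ℝ} (hr : 0 < r) {T : ℝ} {u : ℝ → T3 → V3} (hu : Torus.IsSmoothSpaceTimeOn (Ico 0 T) u)
    {e b : ℝ} (he : 0 < e) (hb : 0 ≤ b) (hbe : b + e < T) {τ : ℝ} (hτ : τ ∈ Icc 0 b)
    (hint : ∀ k : Fin 3, IntegrableOn (fun s => ∫ x, (Torus.timeDerivWithin (Ico 0 T) u (s + e) x) k * momC r (Φ.flow s z) x k +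
      ∑ j : Fin 3, Mmom r (Φ.flow s z) x j k * Torus.partialDeriv j (fun y => u (s + e) y k) x) (Icc 0 τ) volume)
    (hintx : ∀ k : Fin 3, ∀ s ∈ Icc 0 τ, Integrable (fun x => (Torus.timeDerivWithin (Ico 0 T) u (s + e) x) k * momC r (Φ.flow s z) x k +
      ∑ j : Fin 3, Mmom r (Φ.flow s z) x j k * Torus.partialDeriv j (fun y => u (s + e) y k) x) volume) :
    (∫ x, ⟪u (τ + e) x, momC r (Φ.flow τ z) x⟫_ℝ) - (∫ x, ⟪u (0 + e) x, momC r (Φ.flow 0 z) x⟫_ℝ) =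
      (∫ s in Icc 0 τ, ∫ x, (⟪Torus.timeDerivWithin (Ico 0 T) u (s + e) x, momC r (Φ.flow s z) x⟫_ℝ +
        ∑ i : Fin 3, ∑ j : Fin 3, Torus.partialDeriv j (fun y => u (s + e) y i) x * Mmom r (Φ.flow s z) x i j)) +
      (N + 1 : ℝ)⁻¹ * collisionPairSum (Torus.geometry (Fin 3)) (hsDiameter σ N) (fun s => Φ.flow s z) (Ioc 0 τ)
        (fun s i j => ∑ k : Fin 3, (∫ x, u (s + e) x k * cone r (Φ.flow s z i).1 x) *
          ((Φ.flow s z i).2 k - (vin (Φ.flow s z) i j).1 k)) := by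
  have hγ := Φ.isTrajectory z hz
  have hτ0 : 0 ≤ τ := hτ.1
  -- the cut-off shifted tests
  set ζ : ℝ → ℝ := fun s => Real.smoothTransition ((s - (-(e / 2))) / (-(e / 4) - (-(e / 2)))) *
    Real.smoothTransition (((b + (T - e - b) / 2) - s) / ((b + (T - e - b) / 2) - (b + (T - e - b) / 4))) with hζ
  have hζ1 : ∀ s ∈ Icc 0 τ, ζ s = 1 := fun s hs =>
    plateau_cutShift_eq_one he hbe ⟨by linarith [hs.1], by linarith [hs.2, hτ.2]⟩
  have hφ : ∀ k : Fin 3, Torus.IsSmoothSpaceTimeOn Set.univ fun s x => ζ s * u (s + e) x k := fun k =>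
    isSmoothSpaceTimeOn_cutShift hu he hbe k
  -- the weak equation for each component
  have hweak : ∀ k : Fin 3,
      (∫ x, u (τ + e) x k * momC r (Φ.flow τ z) x k) - (∫ x, u (0 + e) x k * momC r (Φ.flow 0 z) x k) =
      (∫ s in Icc 0 τ, ∫ x, (Torus.timeDerivWithin (Ico 0 T) u (s + e) x) k * momC r (Φ.flow s z) x k +
        ∑ j : Fin 3, Mmom r (Φ.flow s z) x j k * Torus.partialDeriv j (fun y => u (s + e) y k) x) +
      (N + 1 : ℝ)⁻¹ * collisionPairSum (Torus.geometry (Fin 3)) (hsDiameter σ N) (fun s => Φ.flow s z) (Ioc 0 τ)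
        (fun s i j => (∫ x, u (s + e) x k * cone r (Φ.flow s z i).1 x) *
          ((Φ.flow s z i).2 k - (vin (Φ.flow s z) i j).1 k)) := by
    intro k
    have hW := ChaosClosesEulerWeakEquation.stub_weakEquation σ hσ hσ2 N Φ z hz r hr (fun s x => ζ s * u (s + e) x k)
      (hφ k) (fun v => v k) τ hτ0
    dsimp only at hW
    -- identify the pieces
    have hM : ∀ (w : Phase N) (x : T3), (∫ q, 3 / (Real.pi * r ^ 3) * max (1 - Torus.euclidDist q.1 x / r) 0 * q.2 k
        ∂(empiricalMeasure w)) = momC r w x k := fun w x => integral_cone_mul_apply r w x k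
    have hJ : ∀ (w : Phase N) (x : T3) (j : Fin 3), (∫ q, 3 / (Real.pi * r ^ 3) * max (1 - Torus.euclidDist q.1 x / r) 0 *
        (q.2 j * q.2 k) ∂(empiricalMeasure w)) = Mmom r w x j k := fun w x j => integral_cone_mul_mul_apply r w x j k
    simp only [hM, hJ] at hW
    have hL1 : (∫ x, ζ τ * u (τ + e) x k * momC r (Φ.flow τ z) x k) = ∫ x, u (τ + e) x k * momC r (Φ.flow τ z) x k := by
      rw [hζ1 τ ⟨hτ0, le_rfl⟩]; simp
    have hL0 : (∫ x, ζ 0 * u (0 + e) x k * momC r (Φ.flow 0 z) x k) = ∫ x, u (0 + e) x k * momC r (Φ.flow 0 z) x k := by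
      rw [hζ1 0 ⟨le_rfl, hτ0⟩]; simp
    have hI : (∫ s in Icc 0 τ, ∫ x, deriv (fun s' => ζ s' * u (s' + e) x k) s * momC r (Φ.flow s z) x k +
        ∑ j : Fin 3, Mmom r (Φ.flow s z) x j k * Torus.partialDeriv j (fun x => ζ s * u (s + e) x k) x) =
        ∫ s in Icc 0 τ, ∫ x, (Torus.timeDerivWithin (Ico 0 T) u (s + e) x) k * momC r (Φ.flow s z) x k +
          ∑ j : Fin 3, Mmom r (Φ.flow s z) x j k * Torus.partialDeriv j (fun y => u (s + e) y k) x := by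
      refine setIntegral_congr_fun measurableSet_Icc fun s hs => ?_
      refine integral_congr_ae (ae_of_all _ fun x => ?_)
      have hd := deriv_cutShift hu he hbe ⟨hs.1, hs.2.trans hτ.2⟩ x k
      rw [hζ1 s hs]
      simp only [one_mul, hζ]
      rw [hd]
    have hC : (∑ᶠ (s : ℝ) (_ : s ∈ collisionTimes (Torus.geometry (Fin 3)) (hsDiameter σ N) (fun s => Φ.flow s z) ∩ Ioc 0 τ),
        ∑ i : Fin (N + 1), ∑ j : Fin (N + 1),
          (if i ≠ j ∧ ‖(Torus.geometry (Fin 3)).sepVec (Φ.flow s z i).1 (Φ.flow s z j).1‖ = hsDiameter σ N then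
            (∫ x, ζ s * u (s + e) x k * (3 / (Real.pi * r ^ 3) * max (1 - Torus.euclidDist (Φ.flow s z i).1 x / r) 0)) *
              ((Φ.flow s z i).2 k -
                (reflectVel ((Torus.geometry (Fin 3)).sepVec (Φ.flow s z i).1 (Φ.flow s z j).1)
                  ((Φ.flow s z i).2, (Φ.flow s z j).2)).1 k) else 0)) =
        collisionPairSum (Torus.geometry (Fin 3)) (hsDiameter σ N) (fun s => Φ.flow s z) (Ioc 0 τ)
          (fun s i j => (∫ x, u (s + e) x k * cone r (Φ.flow s z i).1 x) *
            ((Φ.flow s z i).2 k - (vin (Φ.flow s z) i j).1 k)) := by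
      rw [collisionPairSum_eq_finsum_ite (fun t => hγ.mem t)]
      refine finsum_mem_congr rfl fun s hs => ?_
      have hs1 : ζ s = 1 := hζ1 s ⟨hs.2.1.le, hs.2.2⟩
      refine Finset.sum_congr rfl fun i _ => Finset.sum_congr rfl fun j _ => ?_
      split_ifs
      · rw [hs1]; simp only [one_mul]; rfl
      · rfl
    rw [hL1, hL0, hI, hC] at hW
    exact hW
  -- sum over the components
  have hLτ : (∫ x, ⟪u (τ + e) x, momC r (Φ.flow τ z) x⟫_ℝ) = ∑ k : Fin 3, ∫ x, u (τ + e) x k * momC r (Φ.flow τ z) x k := by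
    simp_rw [L.inner_eq_sum3]
    rw [integral_finsetSum _ fun k _ => ?_]
    have hτT : τ + e ∈ Ico 0 T := ⟨by linarith, by linarith [hτ.2]⟩
    exact (((EuclideanSpace.proj k : V3 →L[ℝ] ℝ).continuous.comp (hu.isSmooth_slice hτT).continuous).mul
      ((EuclideanSpace.proj k : V3 →L[ℝ] ℝ).continuous.comp (continuous_momC r _))).integrable_unitAddTorus
  have hL0 : (∫ x, ⟪u (0 + e) x, momC r (Φ.flow 0 z) x⟫_ℝ) = ∑ k : Fin 3, ∫ x, u (0 + e) x k * momC r (Φ.flow 0 z) x k := by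
    simp_rw [L.inner_eq_sum3]
    rw [integral_finsetSum _ fun k _ => ?_]
    have h0T : 0 + e ∈ Ico 0 T := ⟨by linarith, by linarith⟩
    exact (((EuclideanSpace.proj k : V3 →L[ℝ] ℝ).continuous.comp (hu.isSmooth_slice h0T).continuous).mul
      ((EuclideanSpace.proj k : V3 →L[ℝ] ℝ).continuous.comp (continuous_momC r _))).integrable_unitAddTorus
  have hR : (∫ s in Icc 0 τ, ∫ x, (⟪Torus.timeDerivWithin (Ico 0 T) u (s + e) x, momC r (Φ.flow s z) x⟫_ℝ +
        ∑ i : Fin 3, ∑ j : Fin 3, Torus.partialDeriv j (fun y => u (s + e) y i) x * Mmom r (Φ.flow s z) x i j)) =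
      ∑ k : Fin 3, ∫ s in Icc 0 τ, ∫ x, (Torus.timeDerivWithin (Ico 0 T) u (s + e) x) k * momC r (Φ.flow s z) x k +
        ∑ j : Fin 3, Mmom r (Φ.flow s z) x j k * Torus.partialDeriv j (fun y => u (s + e) y k) x := by
    rw [← integral_finsetSum _ fun k _ => hint k]
    refine setIntegral_congr_fun measurableSet_Icc fun s hs => ?_
    rw [← integral_finsetSum _ fun k _ => hintx k s hs]
    refine integral_congr_ae (ae_of_all _ fun x => ?_)
    beta_reduce
    rw [L.inner_eq_sum3, ← Finset.sum_add_distrib]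
    refine Finset.sum_congr rfl fun k _ => ?_
    congr 1
    refine Finset.sum_congr rfl fun j _ => ?_
    rw [Mmom_symm r _ x k j]; ring
  have hColl : collisionPairSum (Torus.geometry (Fin 3)) (hsDiameter σ N) (fun s => Φ.flow s z) (Ioc 0 τ)
        (fun s i j => ∑ k : Fin 3, (∫ x, u (s + e) x k * cone r (Φ.flow s z i).1 x) *
          ((Φ.flow s z i).2 k - (vin (Φ.flow s z) i j).1 k)) =
      ∑ k : Fin 3, collisionPairSum (Torus.geometry (Fin 3)) (hsDiameter σ N) (fun s => Φ.flow s z) (Ioc 0 τ)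
        (fun s i j => (∫ x, u (s + e) x k * cone r (Φ.flow s z i).1 x) *
          ((Φ.flow s z i).2 k - (vin (Φ.flow s z) i j).1 k)) := by
    have hfin : (collisionTimes (Torus.geometry (Fin 3)) (hsDiameter σ N) (fun s => Φ.flow s z) ∩ Ioc 0 τ).Finite :=
      (hγ.locFinite 0 τ).subset (Set.inter_subset_inter_right _ Ioc_subset_Icc_self)
    simp only [collisionPairSum_eq_finset_sum hfin]
    rw [Finset.sum_comm]
    refine Finset.sum_congr rfl fun s _ => ?_
    rw [Finset.sum_comm]
  rw [hLτ, hL0, hR, hColl, Finset.mul_sum, ← Finset.sum_sub_distrib, ← Finset.sum_add_distrib]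
  exact Finset.sum_congr rfl fun k _ => hweak k

/-! ## §5 The registered sub-goal -/

/-- **Registered sub-goal `stub_reductionWeak` (helper of `stub_kineticReduction`): the `vₖ`-moment of the weak
equation is the `k`-th component of the cone-mollified momentum.** [folklore] -/
theorem stub_reductionWeak : ∀ {N : ℕ} (r : ℝ) (w : Config (N + 1) (Fin 3) T3) (x : T3) (k : Fin 3), ∫ q, cone r q.1 x * q.2 k ∂(empiricalMeasure w) = momC r w x k :=
  fun r w x k => integral_cone_mul_apply r w x k

end Summit.AtomisticToContinuum.HydrodynamicLimit.Theorems.ChaosClosesEulerReduction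

end
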